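import Summits.AtomisticToContinuum.Crystallization.Theorems.UniformBindingRigidity.Negative.DepthZero
import Summits.AtomisticToContinuum.Crystallization.Theorems.PhononSlackCertificatesNearFarGlueRHoles

/-!
# The depth-zero witness is bound below the crux level `2e*` itself

Companion to `Negative/DepthZero.lean` (crux `PerronTransitivity.UniformBindingRigidity`,
stmt-AtomisticToContinuum-15099, line `registered`).  There the depth-zero strengthening of the `e*`-free
half-space core `(CORE)` was refuted by the explicit `1/4`-separated thick half-space configuration
`DepthZero.Y ∋ 0` whose top site is bound at `≤ -7/4`.  The tree also holds a certified FLOOR on the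
periodic infimum, `-0.7865 ≤ e*` (`PhononSlackCertificatesNearFarGlueR.neg_twoCone_le_eStar`, from the
two-cone stability bound `E(N) ≥ -0.7865·N` and `E(N)/N → e*`), hence `2e* ≥ -1.573 > -7/4`: the same
witness is bound STRICTLY BELOW the crux's own level `2e*` at its top site.  Consequently the depth-zero
(single-site) strengthening of the original cohesion stub `(NHB-thick)` — "the TOP site of every
`1/4`-separated thick half-space configuration through `0` is bound `> 2e*`" — is false as well, and this
is certifiable in spite of the certification barrier of `Disproof.lean` §3 (which concerns witnesses INSIDE
the uniformly bound class; the barrier needs `e*` only from above, this lemma only the crude floor).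
All `[folklore]`.
-/

noncomputable section

namespace Summit.AtomisticToContinuum.Crystallization.Theorems.UniformBindingRigidity.Negative.DepthZero

open scoped BigOperators
open Literature.MathematicalPhysics.StatisticalMechanics
open Summit.AtomisticToContinuum.Crystallization.Theorems.PhononSlackCertificatesNearFarGlueR
  (neg_twoCone_le_eStar)

/-- `-7/4 < 2e*` (from the two-cone floor `e* ≥ -0.7865`). [folklore] -/
theorem neg_seven_fourths_lt_two_mul_iInf :
    -(7 / 4 : ℝ) < 2 * ⨅ Q : PeriodicConfiguration 3, Q.energyPerParticle lennardJones := by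
  have h := neg_twoCone_le_eStar
  linarith

/-- **The top site of the depth-zero witness is bound strictly below `2e*`.** [folklore] -/
theorem exists_halfSpace_topSite_lt_level :
    ∃ (Y : Set (EuclideanSpace ℝ (Fin 3))) (u : EuclideanSpace ℝ (Fin 3)), ‖u‖ = 1 ∧
      (0 : EuclideanSpace ℝ (Fin 3)) ∈ Y ∧
      (∀ p ∈ Y, ∀ q ∈ Y, p ≠ q → 1 / 4 ≤ dist p q) ∧
      (∀ q ∈ Y, inner ℝ q u ≤ 0) ∧
      (∀ t : ℝ, ∃ q ∈ Y, inner ℝ q u < -t) ∧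
      ∑' q : {q : EuclideanSpace ℝ (Fin 3) // q ∈ Y ∧ q ≠ 0}, lennardJones (dist 0 q.1) <
        2 * ⨅ Q : PeriodicConfiguration 3, Q.energyPerParticle lennardJones := by
  obtain ⟨Y, u, hu, h0, hsep, hhalf, hthick, htop⟩ := exists_halfSpace_topSite_bound
  exact ⟨Y, u, hu, h0, hsep, hhalf, hthick, htop.trans_lt neg_seven_fourths_lt_two_mul_iInf⟩

/-- **`(NHB-thick)` is false at depth zero**: it is NOT true that the top site `0` of every
`1/4`-separated thick half-space configuration through `0` has Lennard-Jones site sum `> 2e*` — so every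
proof of the cohesion stub (in either form, `(NHB-thick)` or `(CORE)`) must locate the under-bound site
using the bounds at other sites. [folklore] -/
theorem nhbThick_depthZero_false :
    ¬ ∀ (Y : Set (EuclideanSpace ℝ (Fin 3))) (u : EuclideanSpace ℝ (Fin 3)), ‖u‖ = 1 →
      (0 : EuclideanSpace ℝ (Fin 3)) ∈ Y →
      (∀ p ∈ Y, ∀ q ∈ Y, p ≠ q → 1 / 4 ≤ dist p q) →
      (∀ q ∈ Y, inner ℝ q u ≤ 0) →
      (∀ t : ℝ, ∃ q ∈ Y, inner ℝ q u < -t) →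
      2 * (⨅ Q : PeriodicConfiguration 3, Q.energyPerParticle lennardJones) <
        ∑' q : {q : EuclideanSpace ℝ (Fin 3) // q ∈ Y ∧ q ≠ 0}, lennardJones (dist 0 q.1) := by
  intro h
  obtain ⟨Y, u, hu, h0, hsep, hhalf, hthick, htop⟩ := exists_halfSpace_topSite_lt_level
  exact absurd (h Y u hu h0 hsep hhalf hthick) (not_lt.2 htop.le)

end Summit.AtomisticToContinuum.Crystallization.Theorems.UniformBindingRigidity.Negative.DepthZero

end
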